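import Summits.QuantumFields.YangMills.Theorems.BalabanLadderIRcofEquipartitionSeamSliceKernelZPackage
import HarnessLib

/-!
# Crux `IRcof` (stmt-QuantumFields-26930) · line `equipartition_seam` (row 47) · located stub L `SpectralDict.SliceRealisationV` — helper:
# the gauge-averaged SLICE KERNEL of a GENERAL weight, F6 ∕ 7 — §12 the (W) side, torus half: `secW` as a layered slice integral carrying the pulled-back species (`seamField`, `torusLift_symm_assembleZero`, `secW_withEl_eq_integral_layers`)

SOURCE OF RECORD: `Cruxes/IRcof/Lines/equipartition_seam_SliceKernel.lean` rev 9 (crux write 148dcb46cebb, 2172 l.; author ideator ym-ir-idea-22 g7; critic ym-ir-crit-3 g5 TYPEREADs CLEAN of revs 1–6 (bus l.1748 ∕ 1758 ∕ 1768 ∕ 1775 ∕ 1780), placement ruling H1 ∕ H2 (l.1748: §1 → Literature = lit-4 L34 p694639; §2 onward → ≤ 400-line Theorems files) — split VERBATIM along its §§ by LEAD prover ym-ir-line-ab-p1 g8 on the ideator's LAND-ASK H2 (bus l.1786 ∕ l.1789: files F1–F7, each importing the previous).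

HONEST FRAMING.  Elementary measure theory ∕ Fubini on compact groups (Lüscher 1977 ∕ Osterwalder–Seiler 1978 transfer-matrix positivity, weight-generic); proves NO located stub of row 47 by itself (S1, S3ʷ, T, L, N, S5ᵛ open); row 47 class PWP, mechanism 0, width 0; `IRcof` ∕ `IR` 0∕1; the Yang–Mills mass gap (Clay) is NOT proved by anything in this tree; R4 closes only the conditional finite-𝕋⁴ rung `BalabanLadder.UV`.
-/

noncomputable section

open MeasureTheory ProbabilityTheory Finset Filter Function
open scoped BigOperators

namespace Summit.QuantumFields.YangMills.Cruxes.IRcof.EquipartitionSeam.SliceKernel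

open Literature.Analysis.Matrix (IsPosDefKernel isPosDefKernel_const IsPosDefKernel.integral_prod_nonneg_of_measurable)
open Literature.MathematicalPhysics.QuantumFieldTheory (haarProbability integral_integral_fibreAverage_nonneg
  integrable_of_abs_le_one abs_mul_mul_le_one abs_integral_le_one)
open Literature.MathematicalPhysics.QuantumFieldTheory
open Summit.QuantumFields.YangMills.Cruxes.IRcof.EquipartitionSeam.KernelCurrency (sectorTensor withEl secZ secW)
open Literature.MathematicalPhysics.QuantumLattice (torusLift torusEdge)


/-! ## §12 The (W) side, torus half: `secW` as a layered slice integral carrying the pulled-back species; the pull-back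
read through `assembleZero`; its time window; centre-blindness -/

section SeamField

variable {m b₁ b₂ b₃ : ℕ} {G H : Type} [Group G] [Group H] (π : H →* G)

/-- The seam field of temporal layer `t` of the electric family: `elTwist π e` on layer `0`, trivial on the other layers. -/
def seamField (e : Fin 3 → ↥π.ker) (t : Fin m) : FinSpatialSite b₁ b₂ b₃ × Fin 3 → H :=
  fun l => if (t : ℕ) = 0 then elTwist π e l else 1

/-- Auxiliary `seamField_eq` of the slice-kernel port (its statement is its type; rôle explained in the module ∕ section docstrings). -/
theorem seamField_eq (z₀ : Sector π) (e : Fin 3 → ↥π.ker) (t : Fin m) :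
    (fun l : FinSpatialSite b₁ b₂ b₃ × Fin 3 =>
        tHooftTwistTensor (sectorTensor π (withEl π z₀ e)) ((t, l.1) : FinTorusSite m b₁ b₂ b₃) 0 l.2.succ) =
      seamField π e t := by
  funext l
  rw [twistTensor_withEl_electric π z₀ e t l.1 l.2]
  unfold seamField elTwist
  by_cases ht : (t : ℕ) = 0 <;> by_cases hs : spCoord l.1 l.2 = 0 <;> simp [ht, hs]

/-- Auxiliary `seamField_mem_center` of the slice-kernel port (its statement is its type; rôle explained in the module ∕ section docstrings). -/
theorem seamField_mem_center (hker : π.ker ≤ Subgroup.center H) (e : Fin 3 → ↥π.ker) (t : Fin m)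
    (l : FinSpatialSite b₁ b₂ b₃ × Fin 3) : seamField π e t l ∈ Subgroup.center H := by
  unfold seamField
  split_ifs
  · exact elTwist_mem_center π hker e l
  · exact Subgroup.one_mem _

/-- Auxiliary `seamField_zero` of the slice-kernel port (its statement is its type; rôle explained in the module ∕ section docstrings). -/
theorem seamField_zero (e : Fin 3 → ↥π.ker) :
    (seamField π e (0 : Fin (m + 1)) : FinSpatialSite b₁ b₂ b₃ × Fin 3 → H) = elTwist π e := by
  funext l; simp [seamField]

/-- Auxiliary `seamField_of_ne_zero` of the slice-kernel port (its statement is its type; rôle explained in the module ∕ section docstrings). -/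
theorem seamField_of_ne_zero (e : Fin 3 → ↥π.ker) {t : Fin m} (ht : (t : ℕ) ≠ 0) :
    (seamField π e t : FinSpatialSite b₁ b₂ b₃ × Fin 3 → H) = 1 := by
  funext l; simp [seamField, ht]

/-- **Layer decomposition of the electric family, any time extent `m`:** magnetic slice weights `magW` times, for every temporal
layer `t`, the temporal kernel word with the layer's seam field moved onto the later slice. (§9's `prod_plane_assembleZero_withEl`
is the case `m = 1 + M + 1` with the layer-`0` factor split off.) -/
theorem prod_plane_assembleZero_withEl_all (w : H → ℝ) (hcl : ∀ g h : H, w (g * h * g⁻¹) = w h)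
    (hker : π.ker ≤ Subgroup.center H) (z₀ : Sector π) (e : Fin 3 → ↥π.ker)
    (VE : (Fin m → (FinSpatialSite b₁ b₂ b₃ × Fin 3 → H)) × (Fin m → (FinSpatialSite b₁ b₂ b₃ → H))) :
    ∏ x : FinTorusSite m b₁ b₂ b₃, ∏ q : Plane,
        w (tHooftTwistTensor (sectorTensor π (withEl π z₀ e)) x q.1.1 q.1.2 *
          finTorusPlaquette (assembleZero VE) x q.1.1 q.1.2) =
      (∏ t, magW π w z₀ (VE.1 t)) *
        ∏ t, tempKernel Prod.fst (fun l : FinSpatialSite b₁ b₂ b₃ × Fin 3 => l.1.shift l.2) w (VE.1 t) (VE.2 t)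
          (ctwist (seamField π e t) (VE.1 (finRotate m t))) := by
  rw [prod_plane_assembleZero]
  refine congrArg₂ (· * ·) (Finset.prod_congr rfl fun t _ => magWeight_withEl π w z₀ e t (VE.1 t))
    (Finset.prod_congr rfl fun t _ => ?_)
  rw [prod_temporal_eq_tempKernel w hcl _ (twistTensor_withEl_electric_mem_center π hker z₀ e) VE t,
    ← seamField_eq π z₀ e t]

end SeamField

section Pullback

variable {G H : Type} [Group G] [Group H] (π : H →* G)

omit [Group H] in
/-- The INVERSE link re-indexing in coordinates: `(finTorusConfigEquivSite H L)⁻¹ U (y, μ) = U (σ⁻¹ y, μ)`. -/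
theorem finTorusConfigEquivSite_symm_apply [MeasurableSpace H] {L : ℕ} [NeZero L]
    (U : FinTorusSite L L L L × Fin 4 → H) (d : Edge 4 L) :
    (finTorusConfigEquivSite H L).symm U d = U ((finTorusSiteEquivSite L).symm d.1, d.2) := by
  have h : finTorusConfigEquivSite H L (fun d' : Edge 4 L => U ((finTorusSiteEquivSite L).symm d'.1, d'.2)) = U := by
    rw [coe_finTorusConfigEquivSite]
    funext l
    simp only [Equiv.symm_apply_apply]
  conv_lhs => rw [← h, MeasurableEquiv.symm_apply_apply]

/-- The `Fin`-box coordinates (time slice, spatial site) below an edge of `ℤ⁴`, mod `L`. -/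
def zCoord (L : ℕ) [NeZero L] (d : Literature.MathematicalPhysics.QuantumLattice.ZdEdge 4) : FinTorusSite L L L L :=
  (finTorusSiteEquivSite L).symm (Literature.Probability.LatticeModels.Torus.proj L d.1)

omit [Group H] in
/-- `zCoord` in coordinates: time slice and spatial site are the `ZMod.finEquiv`-preimages of the reduced coordinates. -/
theorem zCoord_eq (L : ℕ) [NeZero L] (d : Literature.MathematicalPhysics.QuantumLattice.ZdEdge 4) :
    zCoord L d = ((ZMod.finEquiv L).symm ((d.1 0 : ℤ) : ZMod L), (ZMod.finEquiv L).symm ((d.1 1 : ℤ) : ZMod L),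
      (ZMod.finEquiv L).symm ((d.1 2 : ℤ) : ZMod L), (ZMod.finEquiv L).symm ((d.1 3 : ℤ) : ZMod L)) :=
  rfl

omit [Group H] in
/-- **The pulled-back link field of a time-first assembled configuration, edge by edge:** the `L`-periodic lift of
`(finTorusConfigEquivSite H L)⁻¹ (assembleZero (V, E))` at the `ℤ⁴`-edge `d = (x, μ)` is the temporal link `E t p` (`μ = 0`) or
the spatial link `V t (p, i)` (`μ = i + 1`), where `(t, p) = zCoord L d` = `x mod L` in box coordinates. -/
theorem torusLift_symm_assembleZero [MeasurableSpace H] {L : ℕ} [NeZero L]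
    (VE : (Fin L → (FinSpatialSite L L L × Fin 3 → H)) × (Fin L → (FinSpatialSite L L L → H))) (d : Literature.MathematicalPhysics.QuantumLattice.ZdEdge 4) :
    torusLift L ((finTorusConfigEquivSite H L).symm (assembleZero VE)) d =
      Fin.cases (VE.2 (zCoord L d).1 (zCoord L d).2) (fun i : Fin 3 => VE.1 (zCoord L d).1 ((zCoord L d).2, i)) d.2 := by
  simp only [torusLift, Function.comp_apply, torusEdge, finTorusConfigEquivSite_symm_apply]
  rfl

/-- **Time window of the pulled-back species:** `Ã(assembleZero (V, E))` depends on the slices `V t` and temporal layers `E t`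
only for `t` among the time coordinates (mod `L`) of the edges in `A.supp` (from `A.isCylinder`). -/
theorem pullback_assembleZero_congr [MeasurableSpace G] [MeasurableSpace H] {L : ℕ} [NeZero L] (A : YMSpecies G)
    {VE VE' : (Fin L → (FinSpatialSite L L L × Fin 3 → H)) × (Fin L → (FinSpatialSite L L L → H))}
    (h : ∀ d ∈ A.supp, VE.1 (zCoord L d).1 = VE'.1 (zCoord L d).1 ∧ VE.2 (zCoord L d).1 = VE'.2 (zCoord L d).1) :
    A.F (fun d => π (torusLift L ((finTorusConfigEquivSite H L).symm (assembleZero VE)) d)) =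
      A.F (fun d => π (torusLift L ((finTorusConfigEquivSite H L).symm (assembleZero VE')) d)) :=
  A.isCylinder fun d hd => by
    obtain ⟨h1, h2⟩ := h d (Finset.mem_coe.mp hd)
    simp only [torusLift_symm_assembleZero, h1, h2]

/-- **Slice-twist blindness of the pulled-back species:** multiplying the SPATIAL slices, time by time, by `ker π`-valued link
fields does not change `Ã` — the layered form of centre-blindness, used to carry the electric seam across the time window of `A`. -/
theorem pullback_assembleZero_sliceTwist [MeasurableSpace G] [MeasurableSpace H] {L : ℕ} [NeZero L] (A : YMSpecies G)
    (c : Fin L → (FinSpatialSite L L L × Fin 3 → H)) (hc : ∀ t l, c t l ∈ π.ker)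
    (VE : (Fin L → (FinSpatialSite L L L × Fin 3 → H)) × (Fin L → (FinSpatialSite L L L → H))) :
    A.F (fun d => π (torusLift L ((finTorusConfigEquivSite H L).symm
        (assembleZero ((fun t => ctwist (c t) (VE.1 t), VE.2) :
          (Fin L → (FinSpatialSite L L L × Fin 3 → H)) × (Fin L → (FinSpatialSite L L L → H))))) d)) =
      A.F (fun d => π (torusLift L ((finTorusConfigEquivSite H L).symm (assembleZero VE)) d)) := by
  congr 1
  funext d
  rw [torusLift_symm_assembleZero, torusLift_symm_assembleZero]
  obtain ⟨x, μ⟩ := d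
  refine Fin.cases ?_ (fun i => ?_) μ
  · rfl
  · simp only [Fin.cases_succ, ctwist, map_mul, MonoidHom.mem_ker.mp (hc _ _), one_mul]

/-- **Centre-blindness of the pulled-back species:** multiplying the `H`-links by elements of `ker π` does not change
`A.F ∘ π` — the freedom that moves the electric sheet off the support of `A`. -/
theorem pullback_central_mul [MeasurableSpace G] (A : YMSpecies G) (U : Literature.MathematicalPhysics.QuantumLattice.LGConfig 4 H) (c : Literature.MathematicalPhysics.QuantumLattice.ZdEdge 4 → H)
    (hc : ∀ d, c d ∈ π.ker) : A.F (fun d => π (c d * U d)) = A.F (fun d => π (U d)) := by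
  congr 1
  funext d
  rw [map_mul, MonoidHom.mem_ker.mp (hc d), one_mul]

end Pullback

section SecW

variable {G H : Type} [Group G] [Group H] [TopologicalSpace G] [MeasurableSpace G] [BorelSpace G] [TopologicalSpace H]
  [IsTopologicalGroup H] [CompactSpace H] [MeasurableSpace H] [BorelSpace H] [SecondCountableTopology H] (π : H →* G)

/-- **`W_{w,A}(withEl z₀ e; (2S+1)⁴)` AS A LAYERED SLICE INTEGRAL** — the time-first re-indexing of L's (W) side: `secW` equals the
integral over (`2S+1` slices) × (`2S+1` temporal layers) of the pulled-back species (read edge by edge by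
`torusLift_symm_assembleZero`) times the layered weight of `prod_plane_assembleZero_withEl_all` (`magW` on every slice, the temporal
kernel words with the seam `elTwist π e` on layer `0` only).  What then remains of (W) is abstract: integrate out the layers outside
the time window of `A` (§5-type chain with §6's slab for the window) and regroup. -/
theorem secW_withEl_eq_integral_layers (w : H → ℝ) (hw : Continuous w) (hcl : ∀ g h : H, w (g * h * g⁻¹) = w h)
    (hker : π.ker ≤ Subgroup.center H) (hπ : Continuous π) (z₀ : Sector π) (e : Fin 3 → ↥π.ker) (S : ℕ)
    (A : YMSpecies G) :
    secW π w (withEl π z₀ e) S A =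
      ∫ q : (Fin (2 * S + 1) → (FinSpatialSite (2 * S + 1) (2 * S + 1) (2 * S + 1) × Fin 3 → H)) ×
          (Fin (2 * S + 1) → (FinSpatialSite (2 * S + 1) (2 * S + 1) (2 * S + 1) → H)),
        A.F (fun d => π (torusLift (2 * S + 1) ((finTorusConfigEquivSite H (2 * S + 1)).symm (assembleZero q)) d)) *
          ((∏ t, magW π w z₀ (q.1 t)) *
            ∏ t, tempKernel Prod.fst
              (fun l : FinSpatialSite (2 * S + 1) (2 * S + 1) (2 * S + 1) × Fin 3 => l.1.shift l.2) w
              (q.1 t) (q.2 t) (ctwist (seamField π e t) (q.1 (finRotate (2 * S + 1) t))))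
      ∂((Measure.pi fun _ => Measure.pi fun _ : FinSpatialSite (2 * S + 1) (2 * S + 1) (2 * S + 1) × Fin 3 =>
            haarProbability H).prod
          (Measure.pi fun _ => Measure.pi fun _ : FinSpatialSite (2 * S + 1) (2 * S + 1) (2 * S + 1) =>
            haarProbability H)) := by
  have hΦ : Measurable fun U : FinTorusSite (2 * S + 1) (2 * S + 1) (2 * S + 1) (2 * S + 1) × Fin 4 → H =>
      A.F (fun d => π (torusLift (2 * S + 1) ((finTorusConfigEquivSite H (2 * S + 1)).symm U) d)) *
        ∏ x : FinTorusSite (2 * S + 1) (2 * S + 1) (2 * S + 1) (2 * S + 1), ∏ q : Plane,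
          w (tHooftTwistTensor (sectorTensor π (withEl π z₀ e)) x q.1.1 q.1.2 * finTorusPlaquette U x q.1.1 q.1.2) := by
    refine Measurable.mul (A.measurable.comp (measurable_pi_lambda _ fun d => hπ.measurable.comp ?_)) ?_
    · exact (measurable_pi_apply _).comp (finTorusConfigEquivSite H (2 * S + 1)).symm.measurable
    · refine Continuous.measurable (continuous_finsetProd _ fun x _ => continuous_finsetProd _ fun q _ =>
        hw.comp (continuous_const.mul ?_))
      unfold finTorusPlaquette
      fun_prop
  unfold secW
  rw [integral_pi_eq_integral_assembleZero (haarProbability H) hΦ]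
  refine integral_congr_ae (Eventually.of_forall fun q => ?_)
  dsimp only
  rw [prod_plane_assembleZero_withEl_all π w hcl hker z₀ e q]

end SecW

end Summit.QuantumFields.YangMills.Cruxes.IRcof.EquipartitionSeam.SliceKernel

end
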